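import Mathlib
import Literature.MathematicalPhysics.QuantumLattice.DownfoldingIdentities

/-!
# The cuprate four-orbital (Cu d, Cu s, O pₓ, O p_y) layer model: exact Löwdin downfolding to the
# two-orbital `sd`, the three-orbital `dpp` and the one-orbital conduction-band function; the
# range parameter `r` (Andersen–Liechtenstein–Jepsen–Paulsen 1995; Pavarini et al. 2001)

The "chemical" nearest-neighbour tight-binding model of a flat CuO₂ layer keeps four orbitals per
cell — Cu `d_{x²−y²}`, the axial orbital Cu `s`, O_a `pₓ`, O_b `p_y` — with on-site energies
`ε_d, ε_s, ε_p` and the two hoppings `t_pd`, `t_sp`; all intralayer hoppings `t′, t″, …` of the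
one-band model beyond nearest neighbours proceed via Cu `s` [AndersenEtAl1995, Eq. (1) (σ-block)];
[PavariniEtAl2001, text before Eq. (2)].  In the real gauge and with `sx = sin(a kₓ/2)`,
`sy = sin(a k_y/2)` its Bloch matrix is [AndersenEtAl1995, Eq. (1)]

  `H(k) = [[ε_d, 0, 2t_pd sx, −2t_pd sy], [0, ε_s, 2t_sp sx, 2t_sp sy],`
  `        [2t_pd sx, 2t_sp sx, ε_p, 0], [−2t_pd sy, 2t_sp sy, 0, ε_p]]`          (`fourBand`).

Everything below is EXACT algebra of this `4 × 4` matrix (proved; no facts, no approximations):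

* §1 `det_secularMatrix` — the characteristic determinant in closed form (all `k`, all `ε`):
  `det(ε − H) = [(ε−ε_d)(ε−ε_p) − 4t_pd²(1−u)]·[(ε−ε_s)(ε−ε_p) − 4t_sp²(1−u)] − 16 t_pd² t_sp² v²`
  in the coordinates `u = ½(cos kₓ + cos k_y) = 1 − sx² − sy²`, `v = ½(cos kₓ − cos k_y) = sy² − sx²`
  [AndersenEtAl1995, Eq. (6)]; [PavariniEtAl2001, after Eq. (2)] (`uCoord`, `vCoord`, `uCoord_half`,
  `vCoord_half`).
* §2 Löwdin step 1 (oxygen out): the energy-dependent `sd` Hamiltonian [AndersenEtAl1995, Eq. (5)]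
  `H_sd(ε) = [[ε_d + (1−u)(2t_pd)²/(ε−ε_p), −v(2t_pd)(2t_sp)/(ε−ε_p)], [same, ε_s + (1−u)(2t_sp)²/(ε−ε_p)]]`
  IS the Löwdin/Schur downfold `loewdinHam` of `DownfoldingIdentities` for the block split
  (d, s) ⊕ (pₓ, p_y) (`sdHam_eq_loewdinHam`), and `(ε−ε_p)² det(ε − H_sd(ε)) = det(ε − H)`
  (`det_secular_eq_sd`) — "exact in the sense that `det[H − ε]` and `det[H_ii(ε) − ε]` have
  identical zeroes" [AndersenEtAl1995, Eq. (2)].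
* §3 Löwdin step 2 (axial orbital out): the ONE-band function [AndersenEtAl1995, Eqs. (7)–(8)]
  `h(ε) = ε_d + (2t_pd)²/(ε−ε_p)·[1 − u − v²/(1 + s(ε) − u)]`, `s(ε) = (ε_s−ε)(ε−ε_p)/(2t_sp)²`,
  with `det(ε − H) = 4t_sp²(ε−ε_p)(1 + s(ε) − u)(h(ε) − ε)` (`det_secular_eq_oneBand`), hence the
  constant-energy contours `det(ε − H(k)) = 0 ⟺ 1 − u − d(ε) = v²/(1 − u + s(ε))`,
  `d(ε) = (ε−ε_d)(ε−ε_p)/(2t_pd)²` [PavariniEtAl2001, Eq. (2) with `p(ε) = 0` (flat layer)]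
  (`det_fourBand_eq_zero_iff_contour`).  Without the axial channel (`t_sp = 0`) the d-like bands
  solve `d(ε) = 1 − u`, a function of `u` alone — "`t′ = t″ = 0`" [PavariniEtAl2001, p. 3];
  [AndersenEtAl1995, after Eq. (7)] (`det_secular_tsp_zero`).
* §4 The RANGE PARAMETER `r ≡ ½/(1+s)` and `1/(1−u+s) = 2r/(1−2ru)` [PavariniEtAl2001, Eq. (3)]
  (`rangeParam`, `one_div_eq_rangeParam`), the exact first-order-plus-remainder split
  `2r/(1−2ru) = 2r + 4r²u/(1−2ru)` behind "expanded in powers of `2ru`", and the first-order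
  one-band READING: `(1−u) − d_F − 2rv² = (1 − d_F − r/2) − ½(cos kₓ+cos k_y) + r cos kₓ cos k_y −
  (r/4)(cos 2kₓ + cos 2k_y)`, i.e. against Pavarini's one-band form (Eq. (1), hoppings `≥ 0`,
  `ε = −2t(cos kₓ+cos k_y) + 4t′cos kₓ cos k_y − 2t″(cos 2kₓ+cos 2k_y)`) the linearised band
  (`d(ε) ≈ d_F + ḋ(ε−ε_F)`) has `t = 1/(4ḋ)`, `t′ = r/(4ḋ) = r t`, `t″ = t′/2` EXACTLY at first order
  in `r` [PavariniEtAl2001, p. 3: `t = [1−p+o(r)]/4ḋ`, `t′ = [r+o(r)]/4ḋ`, `t″ = ½t′ + o(r)`]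
  (`pavariniBand`, `firstOrder_reading`, `firstOrder_tp_div_t`, `firstOrder_tpp_div_tp`).
* §5 Eliminating the axial orbital ALONE gives the three-band `d–pₓ–p_y` model with O–O hopping
  `t_pp(ε) = t_sp²/(ε_s − ε)` AND the equal-size O–O terms across Cu (`ε_p → ε_p − 4t_pp sx²` on
  `pₓ`, `− 4t_pp sy²` on `p_y`): `det(ε − H) = (ε − ε_s)·det(ε − H_dpp(ε))` [AndersenEtAl1995, §5:
  "2nd-nearest-neighbor O₂x–O₃y as well as 3rd-nearest-neighbor O₂x–O₂x and O₃y–O₃y hoppings, all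
  of size `t_pp = t_sp²/(ε_s − ε)` … must be added"] (`threeBandAxial`, `det_secular_eq_threeBand`).
  (With `ε_d = 0`, `ε_p = −Δ` the matrix `threeBandAxial 0 (−Δ) t_pd c sx sy` is entry-for-entry the
  cell's `Summit.Ventures.CertifiedManyBodySolver.Downfold.Emery.bloch4 Δ t_pd c c sx sy`; not
  imported — Literature does not import Summits.)
* §6 SENSITIVITY of the range parameter to the axial-orbital energy: `∂r/∂ε_s =
  −r²(ε−ε_p)/(2t_sp²)` (`hasDerivAt_rangeParamAt`), negative above the O level — "the materials with
  the larger `r` (lower `ε_s`)" [PavariniEtAl2001, p. 3] (`rangeParamAt_lt_of_lt`).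
* §7 SIZE OF `o(r)`: `|2r/(1−2ru) − 2r| ≤ 4r²|u|/(1−2r|u|) ≤ 4r²/(1−2r)` on the zone (`|u| ≤ 1`,
  `0 ≤ r < ½`), so the first-order reading `t′ = r t` is accurate to the relative factor `2r/(1−2r)`
  [PavariniEtAl2001, Eq. (3), p. 3] (`abs_rangeParam_remainder_le`, `…_of_abs_le_one`,
  `abs_contour_rhs_sub_firstOrder_le`).
* §8 BILAYER through the axial orbital: two identical layers coupled only by `t_ss^⊥` (s–s) decouple
  into even/odd combinations = single layers with `ε_s ± t_ss^⊥` (`bilayer_mulVec_even/odd`,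
  `det_smul_one_sub_bilayer` via `det [[A,B],[B,A]] = det(A+B)det(A−B)`), and the splitting of the
  one-band function is `∝ v²` (`oneBandFun_interlayer_split`, nodal zero `…_nodal`)
  [PavariniEtAl2001, p. 3].
* §9 THE APICAL LEVER: `ε_s = ε_s̄ + 2t_sc²/(ε_F − ε_c)` with the apical hybrid `ε_c` of Eq. (4)
  (`apicalHybridLevel`, `axialLevel`); `ε_s` increases with `t_sc²` and with `ε_c` (`ε_c < ε_F`), so a
  weaker apical coupling (longer Cu–O_apical distance, `t_sc ∝ d⁻²`) LOWERS `ε_s` and RAISES `r`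
  (`rangeParam_apical_lever`) — "`r` increases with `d_{Cu–O_c}`" [PavariniEtAl2001, p. 4, Fig. 3].
* §10 DIMPLED LAYERS: keeping the `(1+u)p(ε)` term of Eq. (2) the first-order reading has
  `t = (1−p)/(4ḋ)` with `t′ = r/(4ḋ)`, `t″ = r/(8ḋ)` unchanged (`firstOrder_reading_dimpled`; hence
  `t′/t = r/(1−p)`, `firstOrder_tp_div_t_dimpled`); `p = s²/(1+s)² ∈ [0,1)` for extended saddle points
  (`dimplingESP`) — "dimpling … reduce[s] `t`" but not the range [PavariniEtAl2001, p. 3].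
* §11 TWO VIRTUAL PATHS OF OPPOSITE SIGN: an `A₁`-type level coupled to the `x²−y²` band through a
  `B₁g` form factor `w(cos kₓ − cos k_y)` and Löwdin-eliminated at band energy `ε` generates the
  dispersion `w²/(ε−ε_ℓ)·(cos kₓ − cos k_y)² = const + pavariniBand 0 t′_ℓ t″_ℓ` with
  `t′_ℓ = −w²/(2(ε−ε_ℓ))`, `t″_ℓ = ½t′_ℓ` (`pathShift_formFactor_eq_pavariniBand`); a level ABOVE the
  band (Cu `4s`) gives `t′_ℓ > 0`, a level BELOW it (Cu `3z²−r²`) gives `t′_ℓ < 0`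
  (`pathTp_pos_of_lt`, `pathTp_neg_of_lt`), the more so the closer it lies (`pathTp_lt_of_lt_below`)
  — "the path `d_{x²−y²} → d_{z²} → d_{x²−y²}` also contributes to `t₂, t₃`, but has an opposite sign
  to the `4s` contribution because the `d_{z²}` level lies below `d_{x²−y²}`, while `4s` above … the
  cancellation should be strong when the energy of the `d_{z²}` orbital is high as in La"
  [SakakibaraEtAl2010, p. 3]; hence the ORBITAL-SPACE LADDER of the `x²−y²`-sector `t′` read off one
  band structure — three-orbital (`z²`, `4s` explicit) `<` one-orbital (both folded) `<` two-orbital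
  (`z²` explicit, `4s` folded), La₂CuO₄ `0.10 < 0.14 < 0.35` in `(|t₂|+|t₃|)/|t₁|`
  [SakakibaraEtAl2010, Table I, p. 3] — is the sign bookkeeping `orbitalSpace_twoOrbital_gt_oneOrbital`,
  `orbitalSpace_twoOrbital_gt_threeOrbital`, `orbitalSpace_oneOrbital_gt_threeOrbital_iff` (the last
  step needs the `4s` path to outweigh the `z²` path, an inequality on `w², ε_ℓ`, not a sign).

Sign/gauge remarks.  `v` is Pavarini's `½(cos kₓ − cos k_y)`; Andersen et al. write `½(cos ak_y −
cos akₓ)` — only `v²` enters §1/§3, and with Pavarini's `v` the off-diagonal of `H_sd` computed from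
Eq. (1) is `−v(2t_pd)(2t_sp)/(ε−ε_p)` as printed in Eq. (5).  Not here: the six-orbital Bloch matrix behind the dimpling term `p(ε)` (only its first-order
READING is recorded, §10), any LDA number, and the convergence of the `2ru` series (we give the exact
remainder instead, §7).

References: O. K. Andersen, A. I. Liechtenstein, O. Jepsen, F. Paulsen, *LDA energy bands,
low-energy Hamiltonians, t′, t″, t⊥(k), and J⊥*, J. Phys. Chem. Solids 56 (1995) 1573,
arXiv:cond-mat/9509044, Eqs. (1), (2), (5)–(8), §5 · E. Pavarini, I. Dasgupta, T. Saha-Dasgupta,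
O. Jepsen, O. K. Andersen, *Band-structure trend in hole-doped cuprates and correlation with
T_c max*, Phys. Rev. Lett. 87 (2001) 047003, arXiv:cond-mat/0012051, Eqs. (1)–(3) and p. 3 ·
H. Sakakibara, H. Usui, K. Kuroki, R. Arita, H. Aoki, *Two-orbital model explains the higher transition
temperature of the single-layer Hg-cuprate superconductor compared to that of the La-cuprate
superconductor*, Phys. Rev. Lett. 105 (2010) 057003, arXiv:1003.1770, Table I and p. 3 (§11).
AI-produced formalisation (H21, cell hubbard-downfold, seat lit-1, 2026-08-26); no facts, no axioms
beyond Mathlib's, no `sorry`.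
-/

noncomputable section

namespace Literature.MathematicalPhysics.QuantumLattice

namespace CuprateFourOrbital

open Matrix

/-! ## §1 The four-orbital Bloch matrix and its characteristic determinant -/

/-- The four-orbital σ Bloch matrix of a flat CuO₂ layer, basis `(Cu d_{x²−y²}, Cu s, O_a pₓ, O_b p_y)`,
real gauge, `sx = sin(a kₓ/2)`, `sy = sin(a k_y/2)`:
`[[ε_d, 0, 2t_pd sx, −2t_pd sy], [0, ε_s, 2t_sp sx, 2t_sp sy], [2t_pd sx, 2t_sp sx, ε_p, 0],
[−2t_pd sy, 2t_sp sy, 0, ε_p]]`. [cite: AndersenEtAl1995, Eq. (1) (σ-block)] -/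
def fourBand (εd εs εp tpd tsp sx sy : ℝ) : Matrix (Fin 4) (Fin 4) ℝ :=
  !![εd, 0, 2 * tpd * sx, -2 * tpd * sy;
     0, εs, 2 * tsp * sx, 2 * tsp * sy;
     2 * tpd * sx, 2 * tsp * sx, εp, 0;
     -2 * tpd * sy, 2 * tsp * sy, 0, εp]

/-- The Bloch matrix is real symmetric (Hermitian in the real gauge).
[cite: AndersenEtAl1995, Eq. (1) (σ-block)] -/
theorem fourBand_isSymm (εd εs εp tpd tsp sx sy : ℝ) : (fourBand εd εs εp tpd tsp sx sy).IsSymm := by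
  unfold fourBand Matrix.IsSymm
  ext i j
  fin_cases i <;> fin_cases j <;> rfl

/-- Pavarini's coordinate `u ≡ ½(cos kₓ + cos k_y)`, written in `sx = sin(kₓ/2)`, `sy = sin(k_y/2)`:
`u = 1 − sx² − sy²` (so `1 − u = sx² + sy²`). [cite: PavariniEtAl2001, after Eq. (2)];
[cite: AndersenEtAl1995, Eq. (6)] -/
def uCoord (sx sy : ℝ) : ℝ := 1 - sx ^ 2 - sy ^ 2

/-- Pavarini's coordinate `v ≡ ½(cos kₓ − cos k_y)`, written in `sx, sy`: `v = sy² − sx²` (Andersen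
et al. use the opposite sign; only `v²` enters the band functions). [cite: PavariniEtAl2001, after
Eq. (2)]; [cite: AndersenEtAl1995, Eq. (6)] -/
def vCoord (sx sy : ℝ) : ℝ := sy ^ 2 - sx ^ 2

/-- `cos θ = 1 − 2 sin²(θ/2)`. [cite: PavariniEtAl2001, after Eq. (2) (the half-angle bookkeeping
behind `u, v`)] -/
theorem cos_eq_one_sub_two_mul_sin_half_sq (θ : ℝ) :
    Real.cos θ = 1 - 2 * Real.sin (θ / 2) ^ 2 := by
  have h := Real.cos_sq (θ / 2)
  rw [show 2 * (θ / 2) = θ by ring] at h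
  have h2 := Real.sin_sq_add_cos_sq (θ / 2)
  linarith

/-- `u = ½(cos kₓ + cos k_y)` at `sx = sin(kₓ/2)`, `sy = sin(k_y/2)`.
[cite: PavariniEtAl2001, after Eq. (2)]; [cite: AndersenEtAl1995, Eq. (6)] -/
theorem uCoord_half (kx ky : ℝ) :
    uCoord (Real.sin (kx / 2)) (Real.sin (ky / 2)) = (Real.cos kx + Real.cos ky) / 2 := by
  rw [uCoord, cos_eq_one_sub_two_mul_sin_half_sq kx, cos_eq_one_sub_two_mul_sin_half_sq ky]
  ring

/-- `v = ½(cos kₓ − cos k_y)` at `sx = sin(kₓ/2)`, `sy = sin(k_y/2)`.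
[cite: PavariniEtAl2001, after Eq. (2)] -/
theorem vCoord_half (kx ky : ℝ) :
    vCoord (Real.sin (kx / 2)) (Real.sin (ky / 2)) = (Real.cos kx - Real.cos ky) / 2 := by
  rw [vCoord, cos_eq_one_sub_two_mul_sin_half_sq kx, cos_eq_one_sub_two_mul_sin_half_sq ky]
  ring

/-- `v² ≤ (1 − u)²`: `|cos kₓ − cos k_y| ≤ 2 − cos kₓ − cos k_y` in the `sx, sy` variables.
[cite: AndersenEtAl1995, Eq. (6) and Fig. 6 (the `uv` square)] -/
theorem vCoord_sq_le (sx sy : ℝ) : vCoord sx sy ^ 2 ≤ (1 - uCoord sx sy) ^ 2 := by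
  simp only [vCoord, uCoord]
  nlinarith [sq_nonneg sx, sq_nonneg sy, mul_nonneg (sq_nonneg sx) (sq_nonneg sy)]

/-- The characteristic matrix `ε·1 − H(k)` written out. [cite: AndersenEtAl1995, Eq. (1)–(2)] -/
def secularMatrix (εd εs εp tpd tsp sx sy ε : ℝ) : Matrix (Fin 4) (Fin 4) ℝ :=
  !![ε - εd, 0, -(2 * tpd * sx), 2 * tpd * sy;
     0, ε - εs, -(2 * tsp * sx), -(2 * tsp * sy);
     -(2 * tpd * sx), -(2 * tsp * sx), ε - εp, 0;
     2 * tpd * sy, -(2 * tsp * sy), 0, ε - εp]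

/-- `ε·1 − fourBand = secularMatrix`. [cite: AndersenEtAl1995, Eq. (1)–(2)] -/
theorem smul_one_sub_fourBand (εd εs εp tpd tsp sx sy ε : ℝ) :
    ε • (1 : Matrix (Fin 4) (Fin 4) ℝ) - fourBand εd εs εp tpd tsp sx sy =
      secularMatrix εd εs εp tpd tsp sx sy ε := by
  ext i j
  fin_cases i <;> fin_cases j <;> simp [fourBand, secularMatrix]

/-- The closed-form characteristic polynomial of the four-orbital model, in `u, v`:
`P(ε) = [(ε−ε_d)(ε−ε_p) − 4t_pd²(1−u)]·[(ε−ε_s)(ε−ε_p) − 4t_sp²(1−u)] − 16 t_pd² t_sp² v²`.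
[cite: AndersenEtAl1995, Eqs. (2), (5)] -/
def secularDet (εd εs εp tpd tsp sx sy ε : ℝ) : ℝ :=
  ((ε - εd) * (ε - εp) - 4 * tpd ^ 2 * (1 - uCoord sx sy)) *
      ((ε - εs) * (ε - εp) - 4 * tsp ^ 2 * (1 - uCoord sx sy)) -
    16 * tpd ^ 2 * tsp ^ 2 * vCoord sx sy ^ 2

/-- **Characteristic determinant in closed form** (all `k`, all `ε`):
`det(ε·1 − H(k)) = [(ε−ε_d)(ε−ε_p) − 4t_pd²(1−u)]·[(ε−ε_s)(ε−ε_p) − 4t_sp²(1−u)] − 16t_pd²t_sp²v²`.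
[cite: AndersenEtAl1995, Eqs. (2), (5)] -/
theorem det_secularMatrix (εd εs εp tpd tsp sx sy ε : ℝ) :
    (secularMatrix εd εs εp tpd tsp sx sy ε).det = secularDet εd εs εp tpd tsp sx sy ε := by
  simp [secularMatrix, Matrix.det_succ_row_zero, Fin.sum_univ_succ, Fin.succAbove, secularDet, uCoord,
    vCoord]
  ring

/-- The same for `det(ε·1 − fourBand)`. [cite: AndersenEtAl1995, Eqs. (2), (5)] -/
theorem det_smul_one_sub_fourBand (εd εs εp tpd tsp sx sy ε : ℝ) :
    (ε • (1 : Matrix (Fin 4) (Fin 4) ℝ) - fourBand εd εs εp tpd tsp sx sy).det =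
      secularDet εd εs εp tpd tsp sx sy ε := by
  rw [smul_one_sub_fourBand, det_secularMatrix]

/-! ## §2 Löwdin step 1: the oxygen orbitals out — the energy-dependent `sd` Hamiltonian -/

/-- The energy-dependent two-orbital `sd` Hamiltonian obtained by Löwdin-downfolding the two oxygen
orbitals at energy `ε ≠ ε_p`:
`[[ε_d + (1−u)(2t_pd)²/(ε−ε_p), −v(2t_pd)(2t_sp)/(ε−ε_p)], [−v(2t_pd)(2t_sp)/(ε−ε_p), ε_s + (1−u)(2t_sp)²/(ε−ε_p)]]`.
[cite: AndersenEtAl1995, Eq. (5)] -/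
def sdHam (εd εs εp tpd tsp sx sy ε : ℝ) : Matrix (Fin 2) (Fin 2) ℝ :=
  !![εd + (1 - uCoord sx sy) * (2 * tpd) ^ 2 / (ε - εp),
      -(vCoord sx sy) * (2 * tpd) * (2 * tsp) / (ε - εp);
     -(vCoord sx sy) * (2 * tpd) * (2 * tsp) / (ε - εp),
      εs + (1 - uCoord sx sy) * (2 * tsp) ^ 2 / (ε - εp)]

/-- Retained block `A = diag(ε_d, ε_s)` of the (d, s) ⊕ (pₓ, p_y) split. [cite: AndersenEtAl1995,
Eqs. (1)–(2)] -/
def blockA (εd εs : ℝ) : Matrix (Fin 2) (Fin 2) ℝ := !![εd, 0; 0, εs]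

/-- Coupling block `B = [[2t_pd sx, −2t_pd sy], [2t_sp sx, 2t_sp sy]]` ((d, s) rows, (pₓ, p_y)
columns) of the split; the lower-left block is `Bᵀ`. [cite: AndersenEtAl1995, Eqs. (1)–(2)] -/
def blockB (tpd tsp sx sy : ℝ) : Matrix (Fin 2) (Fin 2) ℝ :=
  !![2 * tpd * sx, -2 * tpd * sy; 2 * tsp * sx, 2 * tsp * sy]

/-- Coupling block `C = Bᵀ = [[2t_pd sx, 2t_sp sx], [−2t_pd sy, 2t_sp sy]]` ((pₓ, p_y) rows, (d, s)
columns). [cite: AndersenEtAl1995, Eqs. (1)–(2)] -/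
def blockC (tpd tsp sx sy : ℝ) : Matrix (Fin 2) (Fin 2) ℝ :=
  !![2 * tpd * sx, 2 * tsp * sx; -2 * tpd * sy, 2 * tsp * sy]

/-- `C = Bᵀ` (the model is symmetric). [cite: AndersenEtAl1995, Eq. (1)] -/
theorem blockC_eq_transpose (tpd tsp sx sy : ℝ) : blockC tpd tsp sx sy = (blockB tpd tsp sx sy)ᵀ := by
  ext i j
  fin_cases i <;> fin_cases j <;> rfl

/-- The four-orbital model as a block matrix over `(d, s) ⊕ (pₓ, p_y)`. [cite: AndersenEtAl1995,
Eqs. (1)–(2)] -/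
def fourBandBlocks (εd εs εp tpd tsp sx sy : ℝ) : Matrix (Fin 2 ⊕ Fin 2) (Fin 2 ⊕ Fin 2) ℝ :=
  Matrix.fromBlocks (blockA εd εs) (blockB tpd tsp sx sy) (blockC tpd tsp sx sy)
    (εp • (1 : Matrix (Fin 2) (Fin 2) ℝ))

/-- `fourBand` is the block matrix re-indexed along `Fin 2 ⊕ Fin 2 ≃ Fin 4` (d, s, pₓ, p_y in this
order). [cite: AndersenEtAl1995, Eq. (1)] -/
theorem fourBand_eq_reindex (εd εs εp tpd tsp sx sy : ℝ) :
    fourBand εd εs εp tpd tsp sx sy =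
      Matrix.reindex finSumFinEquiv finSumFinEquiv (fourBandBlocks εd εs εp tpd tsp sx sy) := by
  ext i j
  fin_cases i <;> fin_cases j <;>
    simp [fourBand, fourBandBlocks, blockA, blockB, blockC, Matrix.reindex_apply, finSumFinEquiv,
      Fin.addCases, Matrix.fromBlocks]

/-- For `ε ≠ ε_p` the inverse of the eliminated block `ε·1 − ε_p·1` is `(ε−ε_p)⁻¹·1`.
[cite: AndersenEtAl1995, Eq. (2)] -/
theorem inv_smul_one_sub (εp ε : ℝ) (hε : ε ≠ εp) :
    (ε • (1 : Matrix (Fin 2) (Fin 2) ℝ) - εp • (1 : Matrix (Fin 2) (Fin 2) ℝ))⁻¹ =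
      (ε - εp)⁻¹ • (1 : Matrix (Fin 2) (Fin 2) ℝ) := by
  have hne : ε - εp ≠ 0 := sub_ne_zero.mpr hε
  have h1 : ε • (1 : Matrix (Fin 2) (Fin 2) ℝ) - εp • 1 = (ε - εp) • (1 : Matrix (Fin 2) (Fin 2) ℝ) := by
    rw [sub_smul]
  rw [h1]
  apply Matrix.inv_eq_left_inv
  rw [Matrix.smul_mul, Matrix.one_mul, smul_smul, inv_mul_cancel₀ hne, one_smul]

/-- **The `sd` Hamiltonian is the Löwdin downfold** of the four-orbital block matrix onto (d, s) at
energy `ε ≠ ε_p`: `H_sd(ε) = A + B (ε·1 − ε_p·1)⁻¹ Bᵀ = loewdinHam A B Bᵀ (ε_p·1) ε`.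
[cite: AndersenEtAl1995, Eqs. (2), (5)] -/
theorem sdHam_eq_loewdinHam (εd εs εp tpd tsp sx sy ε : ℝ) (hε : ε ≠ εp) :
    sdHam εd εs εp tpd tsp sx sy ε =
      loewdinHam (blockA εd εs) (blockB tpd tsp sx sy) (blockC tpd tsp sx sy)
        (εp • (1 : Matrix (Fin 2) (Fin 2) ℝ)) ε := by
  have hne : ε - εp ≠ 0 := sub_ne_zero.mpr hε
  rw [loewdinHam, inv_smul_one_sub εp ε hε, Matrix.mul_smul, Matrix.mul_one, Matrix.smul_mul]
  ext i j
  fin_cases i <;> fin_cases j <;>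
    simp [sdHam, blockA, blockB, blockC, uCoord, vCoord] <;>
    field_simp <;> ring

/-- **Step 1 preserves the zeros**: `(ε − ε_p)² · det(ε·1 − H_sd(ε)) = det(ε·1 − H(k))` for `ε ≠ ε_p`
("exact in the sense that `det[H − ε]` and `det[H_ii(ε) − ε]` have identical zeroes").
[cite: AndersenEtAl1995, Eqs. (2), (5)] -/
theorem det_secular_eq_sd (εd εs εp tpd tsp sx sy ε : ℝ) (hε : ε ≠ εp) :
    (ε - εp) ^ 2 * (ε • (1 : Matrix (Fin 2) (Fin 2) ℝ) - sdHam εd εs εp tpd tsp sx sy ε).det =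
      secularDet εd εs εp tpd tsp sx sy ε := by
  have hne : ε - εp ≠ 0 := sub_ne_zero.mpr hε
  simp [sdHam, Matrix.det_fin_two, Matrix.sub_apply, Matrix.smul_apply, secularDet]
  field_simp
  ring

/-- Hence for `ε ≠ ε_p`: `det(ε·1 − H(k)) = 0 ⟺ det(ε·1 − H_sd(ε)) = 0`.
[cite: AndersenEtAl1995, Eqs. (2), (5)] -/
theorem det_fourBand_eq_zero_iff_sd (εd εs εp tpd tsp sx sy ε : ℝ) (hε : ε ≠ εp) :
    (ε • (1 : Matrix (Fin 4) (Fin 4) ℝ) - fourBand εd εs εp tpd tsp sx sy).det = 0 ↔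
      (ε • (1 : Matrix (Fin 2) (Fin 2) ℝ) - sdHam εd εs εp tpd tsp sx sy ε).det = 0 := by
  have hne : ε - εp ≠ 0 := sub_ne_zero.mpr hε
  rw [det_smul_one_sub_fourBand, ← det_secular_eq_sd εd εs εp tpd tsp sx sy ε hε, mul_eq_zero]
  constructor
  · rintro (h | h)
    · exact absurd h (pow_ne_zero 2 hne)
    · exact h
  · intro h
    exact Or.inr h

/-! ## §3 Löwdin step 2: the axial orbital out — the one-band function and Pavarini's contour equation -/

/-- Pavarini's `pd` scattering function `d(ε) ≡ (ε−ε_d)(ε−ε_p)/(2t_pd)²`.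
[cite: PavariniEtAl2001, after Eq. (2)] -/
def dFun (εd εp tpd ε : ℝ) : ℝ := (ε - εd) * (ε - εp) / (4 * tpd ^ 2)

/-- The `sp` scattering function `s(ε) ≡ (ε_s−ε)(ε−ε_p)/(2t_sp)²`. [cite: AndersenEtAl1995, Eq. (8)];
[cite: PavariniEtAl2001, after Eq. (2)] -/
def sFun (εs εp tsp ε : ℝ) : ℝ := (εs - ε) * (ε - εp) / (4 * tsp ^ 2)

/-- The energy-dependent ONE-band function
`h(ε) = ε_d + (2t_pd)²/(ε−ε_p)·[1 − u − v²/(1 + s(ε) − u)]`. [cite: AndersenEtAl1995, Eq. (7)] -/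
def oneBandFun (εd εs εp tpd tsp sx sy ε : ℝ) : ℝ :=
  εd + (2 * tpd) ^ 2 / (ε - εp) *
    (1 - uCoord sx sy - vCoord sx sy ^ 2 / (1 + sFun εs εp tsp ε - uCoord sx sy))

/-- **The four-orbital determinant factorises through the one-band function**: for `ε ≠ ε_p`,
`t_sp ≠ 0` and `1 + s(ε) − u ≠ 0`,
`det(ε·1 − H(k)) = 4t_sp²(ε−ε_p)(1 + s(ε) − u)·(h(ε) − ε)`.
[cite: AndersenEtAl1995, Eqs. (2), (7)] -/
theorem det_secular_eq_oneBand (εd εs εp tpd tsp sx sy ε : ℝ) (hε : ε ≠ εp) (htsp : tsp ≠ 0)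
    (hs : 1 + sFun εs εp tsp ε - uCoord sx sy ≠ 0) :
    (ε • (1 : Matrix (Fin 4) (Fin 4) ℝ) - fourBand εd εs εp tpd tsp sx sy).det =
      4 * tsp ^ 2 * (ε - εp) * (1 + sFun εs εp tsp ε - uCoord sx sy) *
        (oneBandFun εd εs εp tpd tsp sx sy ε - ε) := by
  have hne : ε - εp ≠ 0 := sub_ne_zero.mpr hε
  have h4 : 4 * tsp ^ 2 ≠ 0 := mul_ne_zero (by norm_num) (pow_ne_zero 2 htsp)
  rw [det_smul_one_sub_fourBand]
  unfold oneBandFun secularDet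
  set Q := 1 + sFun εs εp tsp ε - uCoord sx sy with hQ
  field_simp
  rw [hQ]
  unfold sFun
  field_simp
  ring

/-- **Identical zeros** ("`(7)` … is still equivalent with `|H − ε| = 0`"): for `ε ≠ ε_p`,
`t_sp ≠ 0`, `1 + s(ε) − u ≠ 0`: `det(ε·1 − H(k)) = 0 ⟺ h(ε) = ε`.
[cite: AndersenEtAl1995, Eqs. (2), (7)] -/
theorem det_fourBand_eq_zero_iff_oneBand (εd εs εp tpd tsp sx sy ε : ℝ) (hε : ε ≠ εp)
    (htsp : tsp ≠ 0) (hs : 1 + sFun εs εp tsp ε - uCoord sx sy ≠ 0) :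
    (ε • (1 : Matrix (Fin 4) (Fin 4) ℝ) - fourBand εd εs εp tpd tsp sx sy).det = 0 ↔
      oneBandFun εd εs εp tpd tsp sx sy ε = ε := by
  have hne : ε - εp ≠ 0 := sub_ne_zero.mpr hε
  rw [det_secular_eq_oneBand εd εs εp tpd tsp sx sy ε hε htsp hs]
  have h4 : 4 * tsp ^ 2 * (ε - εp) * (1 + sFun εs εp tsp ε - uCoord sx sy) ≠ 0 := by
    apply mul_ne_zero (mul_ne_zero (mul_ne_zero (by norm_num) (pow_ne_zero 2 htsp)) hne) hs
  rw [mul_eq_zero, sub_eq_zero]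
  constructor
  · rintro (h | h)
    · exact absurd h h4
    · exact h
  · intro h
    exact Or.inr h

/-- **Pavarini's constant-energy-contour equation** (flat layer, `p(ε) = 0`): for `ε ≠ ε_p`,
`t_pd ≠ 0`, `t_sp ≠ 0`, `1 − u + s(ε) ≠ 0`,
`det(ε·1 − H(k)) = 0 ⟺ 1 − u − d(ε) = v²/(1 − u + s(ε))`.
[cite: PavariniEtAl2001, Eq. (2)] -/
theorem det_fourBand_eq_zero_iff_contour (εd εs εp tpd tsp sx sy ε : ℝ) (hε : ε ≠ εp)
    (htpd : tpd ≠ 0) (htsp : tsp ≠ 0) (hs : 1 - uCoord sx sy + sFun εs εp tsp ε ≠ 0) :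
    (ε • (1 : Matrix (Fin 4) (Fin 4) ℝ) - fourBand εd εs εp tpd tsp sx sy).det = 0 ↔
      1 - uCoord sx sy - dFun εd εp tpd ε = vCoord sx sy ^ 2 / (1 - uCoord sx sy + sFun εs εp tsp ε) := by
  have hne : ε - εp ≠ 0 := sub_ne_zero.mpr hε
  have h4 : (2 * tpd) ^ 2 ≠ 0 := pow_ne_zero 2 (mul_ne_zero two_ne_zero htpd)
  have hs' : 1 + sFun εs εp tsp ε - uCoord sx sy ≠ 0 := by
    intro h; apply hs; linarith
  rw [det_fourBand_eq_zero_iff_oneBand εd εs εp tpd tsp sx sy ε hε htsp hs']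
  have e1 : 1 - uCoord sx sy + sFun εs εp tsp ε = 1 + sFun εs εp tsp ε - uCoord sx sy := by ring
  rw [e1]
  unfold oneBandFun dFun
  set W := vCoord sx sy ^ 2 / (1 + sFun εs εp tsp ε - uCoord sx sy) with hW
  constructor
  · intro h
    field_simp at h
    field_simp
    linear_combination h
  · intro h
    field_simp at h
    field_simp
    linear_combination h

/-- **No axial channel ⇒ nearest-neighbour-only band**: at `t_sp = 0` the determinant factorises as
`[(ε−ε_d)(ε−ε_p) − 4t_pd²(1−u)]·(ε−ε_s)(ε−ε_p)`, so the d-like bands solve `d(ε) = 1 − u`, a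
function of `u = ½(cos kₓ + cos k_y)` alone ("if `ε_s` were infinitely far above the conduction band,
or `t_sp` vanishingly small … the constant-energy contours would depend only on `u` … `t′ = t″ = 0`").
[cite: PavariniEtAl2001, p. 3]; [cite: AndersenEtAl1995, after Eq. (7)] -/
theorem det_secular_tsp_zero (εd εs εp tpd sx sy ε : ℝ) :
    (ε • (1 : Matrix (Fin 4) (Fin 4) ℝ) - fourBand εd εs εp tpd 0 sx sy).det =
      ((ε - εd) * (ε - εp) - 4 * tpd ^ 2 * (1 - uCoord sx sy)) * ((ε - εs) * (ε - εp)) := by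
  rw [det_smul_one_sub_fourBand, secularDet]
  ring

/-- The `t_sp = 0` zero set away from the decoupled levels: for `ε ≠ ε_p`, `ε ≠ ε_s`, `t_pd ≠ 0`:
`det(ε·1 − H(k)) = 0 ⟺ d(ε) = 1 − u`. [cite: PavariniEtAl2001, p. 3] -/
theorem det_fourBand_tsp_zero_eq_zero_iff (εd εs εp tpd sx sy ε : ℝ) (hε : ε ≠ εp) (hεs : ε ≠ εs)
    (htpd : tpd ≠ 0) :
    (ε • (1 : Matrix (Fin 4) (Fin 4) ℝ) - fourBand εd εs εp tpd 0 sx sy).det = 0 ↔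
      dFun εd εp tpd ε = 1 - uCoord sx sy := by
  have hne : ε - εp ≠ 0 := sub_ne_zero.mpr hε
  have hnes : ε - εs ≠ 0 := sub_ne_zero.mpr hεs
  have h4 : 4 * tpd ^ 2 ≠ 0 := mul_ne_zero (by norm_num) (pow_ne_zero 2 htpd)
  rw [det_secular_tsp_zero, mul_eq_zero, dFun]
  constructor
  · rintro (h | h)
    · rw [div_eq_iff h4]; linarith
    · exact absurd h (mul_ne_zero hnes hne)
  · intro h
    left
    rw [div_eq_iff h4] at h
    linarith

/-! ## §4 The range parameter `r` -/

/-- The RANGE PARAMETER `r ≡ ½/(1 + s)`. [cite: PavariniEtAl2001, Eq. (3)] -/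
def rangeParam (s : ℝ) : ℝ := (1 / 2) / (1 + s)

/-- **Eq. (3)**: `1/(1 − u + s) = 2r/(1 − 2ru)` with `r = ½/(1+s)` (for `1 + s ≠ 0`, `1 − u + s ≠ 0`).
[cite: PavariniEtAl2001, Eq. (3)] -/
theorem one_div_eq_rangeParam (u s : ℝ) (h1 : 1 + s ≠ 0) (h2 : 1 - u + s ≠ 0) :
    1 / (1 - u + s) = 2 * rangeParam s / (1 - 2 * rangeParam s * u) := by
  unfold rangeParam
  have h3 : 1 - 2 * (1 / 2 / (1 + s)) * u = (1 - u + s) / (1 + s) := by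
    field_simp
    ring
  rw [h3]
  field_simp

/-- `1 − 2ru = (1 − u + s)/(1 + s)`: the two denominators vanish together. [cite: PavariniEtAl2001,
Eq. (3)] -/
theorem one_sub_two_mul_rangeParam_mul (u s : ℝ) (h1 : 1 + s ≠ 0) :
    1 - 2 * rangeParam s * u = (1 - u + s) / (1 + s) := by
  unfold rangeParam
  field_simp
  ring

/-- For `s > 0` (the physical regime near the middle of the conduction band, where `d, s, p` are
positive) the range parameter lies in `(0, ½)`. [cite: PavariniEtAl2001, p. 2 (after Eq. (2)) and
Eq. (3)] -/
theorem rangeParam_pos_lt_half (s : ℝ) (hs : 0 < s) : 0 < rangeParam s ∧ rangeParam s < 1 / 2 := by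
  unfold rangeParam
  constructor
  · positivity
  · rw [div_lt_iff₀ (by linarith)]
    nlinarith

/-- The EXACT first-order-plus-remainder split behind "expanded in powers of `2ru`":
`2r/(1 − 2ru) = 2r + 4r²u/(1 − 2ru)` (for `1 − 2ru ≠ 0`). [cite: PavariniEtAl2001, Eq. (3) and the
sentence after it] -/
theorem rangeParam_expansion_remainder (u s : ℝ) (h : 1 - 2 * rangeParam s * u ≠ 0) :
    2 * rangeParam s / (1 - 2 * rangeParam s * u) =
      2 * rangeParam s + 4 * rangeParam s ^ 2 * u / (1 - 2 * rangeParam s * u) := by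
  field_simp
  ring

/-- The contour equation in `r`-form: for `ε ≠ ε_p`, `t_pd, t_sp ≠ 0`, `1 + s(ε) ≠ 0`,
`1 − u + s(ε) ≠ 0`: `det(ε·1 − H(k)) = 0 ⟺ 1 − u − d(ε) = 2r(ε)v²/(1 − 2r(ε)u)` with
`r(ε) = ½/(1 + s(ε))`. [cite: PavariniEtAl2001, Eqs. (2)–(3)] -/
theorem det_fourBand_eq_zero_iff_contour_r (εd εs εp tpd tsp sx sy ε : ℝ) (hε : ε ≠ εp)
    (htpd : tpd ≠ 0) (htsp : tsp ≠ 0) (h1 : 1 + sFun εs εp tsp ε ≠ 0)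
    (hs : 1 - uCoord sx sy + sFun εs εp tsp ε ≠ 0) :
    (ε • (1 : Matrix (Fin 4) (Fin 4) ℝ) - fourBand εd εs εp tpd tsp sx sy).det = 0 ↔
      1 - uCoord sx sy - dFun εd εp tpd ε =
        2 * rangeParam (sFun εs εp tsp ε) * vCoord sx sy ^ 2 /
          (1 - 2 * rangeParam (sFun εs εp tsp ε) * uCoord sx sy) := by
  rw [det_fourBand_eq_zero_iff_contour εd εs εp tpd tsp sx sy ε hε htpd htsp hs]
  have key : vCoord sx sy ^ 2 / (1 - uCoord sx sy + sFun εs εp tsp ε) =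
      2 * rangeParam (sFun εs εp tsp ε) * vCoord sx sy ^ 2 /
        (1 - 2 * rangeParam (sFun εs εp tsp ε) * uCoord sx sy) := by
    rw [one_sub_two_mul_rangeParam_mul _ _ h1]
    unfold rangeParam
    field_simp
  rw [key]

/-- Pavarini's one-band dispersion, Eq. (1) truncated after `t″` (hopping integrals `≥ 0` in this
convention): `ε(k) = −2t(cos kₓ + cos k_y) + 4t′ cos kₓ cos k_y − 2t″(cos 2kₓ + cos 2k_y)`.  (The
cell's hubbard-fast dictionary D0 writes `−4t′_{D0} cos kₓ cos k_y`, i.e. `t′_{D0} = −t′`.)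
[cite: PavariniEtAl2001, Eq. (1)] -/
def pavariniBand (t t' t'' kx ky : ℝ) : ℝ :=
  -2 * t * (Real.cos kx + Real.cos ky) + 4 * t' * (Real.cos kx * Real.cos ky)
    - 2 * t'' * (Real.cos (2 * kx) + Real.cos (2 * ky))

/-- **First-order one-band reading.**  Linearising `d(ε) ≈ d_F + ḋ(ε − ε_F)` and keeping the first
order `2r` of `2r/(1−2ru)`, the contour equation reads `ḋ(ε − ε_F) = (1−u) − d_F − 2rv²`, and the
right-hand side is EXACTLY a `t–t′–t″` form:
`(1−u) − d_F − 2rv² = (1 − d_F − r/2) − ½(cos kₓ+cos k_y) + r cos kₓ cos k_y − (r/4)(cos 2kₓ+cos 2k_y)`.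
[cite: PavariniEtAl2001, p. 3 (`t = [1−p+o(r)]/4ḋ`, `t′ = [r+o(r)]/4ḋ`, `t″ = ½t′ + o(r)`)] -/
theorem firstOrder_reading (dF r kx ky : ℝ) :
    (1 - uCoord (Real.sin (kx / 2)) (Real.sin (ky / 2))) - dF -
        2 * r * vCoord (Real.sin (kx / 2)) (Real.sin (ky / 2)) ^ 2 =
      (1 - dF - r / 2) + pavariniBand (1 / 4) (r / 4) (r / 8) kx ky := by
  rw [uCoord_half, vCoord_half, pavariniBand, Real.cos_two_mul, Real.cos_two_mul]
  ring

/-- The same divided by the linearisation slope `ḋ ≠ 0`: the linearised first-order band is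
`ε − ε_F = (1 − d_F − r/2)/ḋ + pavariniBand (1/(4ḋ)) (r/(4ḋ)) (r/(8ḋ))`, i.e. `t = 1/(4ḋ)`,
`t′ = r/(4ḋ)`, `t″ = r/(8ḋ)`. [cite: PavariniEtAl2001, p. 3] -/
theorem firstOrder_reading_div (dF dd r kx ky : ℝ) (hdd : dd ≠ 0) :
    ((1 - uCoord (Real.sin (kx / 2)) (Real.sin (ky / 2))) - dF -
        2 * r * vCoord (Real.sin (kx / 2)) (Real.sin (ky / 2)) ^ 2) / dd =
      (1 - dF - r / 2) / dd + pavariniBand (1 / (4 * dd)) (r / (4 * dd)) (r / (8 * dd)) kx ky := by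
  rw [firstOrder_reading]
  unfold pavariniBand
  field_simp

/-- **`t′/t = r` at first order**: with `t = 1/(4ḋ)` and `t′ = r/(4ḋ)`, `t′/t = r` ("one may think of
`r` as `t′/t`"). [cite: PavariniEtAl2001, p. 3] -/
theorem firstOrder_tp_div_t (dd r : ℝ) (hdd : dd ≠ 0) : (r / (4 * dd)) / (1 / (4 * dd)) = r := by
  field_simp

/-- **`t″/t′ = ½` at first order**: `t″ = r/(8ḋ) = ½ · r/(4ḋ)`. [cite: PavariniEtAl2001, p. 3] -/
theorem firstOrder_tpp_div_tp (dd r : ℝ) : r / (8 * dd) = (1 / 2) * (r / (4 * dd)) := by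
  ring

/-! ## §5 Eliminating the axial orbital alone: the three-band model it generates -/

/-- The three-orbital `(d, pₓ, p_y)` matrix obtained by Löwdin-eliminating the axial orbital at energy
`ε`, written with the generated O–O coupling `c` (`= t_sp²/(ε_s − ε)`): O_a–O_b hopping `−4c sx sy`
AND the across-Cu terms `−4c sx²` on `pₓ`, `−4c sy²` on `p_y` ("2nd-nearest-neighbor O₂x–O₃y as well
as 3rd-nearest-neighbor O₂x–O₂x and O₃y–O₃y hoppings, all of size `t_pp = t_sp²/(ε_s − ε)` … must be
added").  With `ε_d = 0`, `ε_p = −Δ` this is the cell's `Emery.bloch4 Δ t_pd c c sx sy`.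
[cite: AndersenEtAl1995, §5 (3-band Hamiltonian) and Eq. (2)] -/
def threeBandAxial (εd εp tpd c sx sy : ℝ) : Matrix (Fin 3) (Fin 3) ℝ :=
  !![εd, 2 * tpd * sx, -2 * tpd * sy;
     2 * tpd * sx, εp - 4 * c * sx ^ 2, -4 * c * sx * sy;
     -2 * tpd * sy, -4 * c * sx * sy, εp - 4 * c * sy ^ 2]

/-- Characteristic determinant of the generated three-band matrix (all `k`, all `ε`, any `c`).
[cite: AndersenEtAl1995, §5 and Eq. (2)] -/
theorem det_smul_one_sub_threeBandAxial (εd εp tpd c sx sy ε : ℝ) :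
    (ε • (1 : Matrix (Fin 3) (Fin 3) ℝ) - threeBandAxial εd εp tpd c sx sy).det =
      (ε - εd) * ((ε - εp + 4 * c * sx ^ 2) * (ε - εp + 4 * c * sy ^ 2) - 16 * c ^ 2 * sx ^ 2 * sy ^ 2)
        - 4 * tpd ^ 2 * sx ^ 2 * (ε - εp + 4 * c * sy ^ 2)
        - 4 * tpd ^ 2 * sy ^ 2 * (ε - εp + 4 * c * sx ^ 2)
        - 32 * tpd ^ 2 * c * sx ^ 2 * sy ^ 2 := by
  simp [threeBandAxial, Matrix.det_fin_three, Matrix.sub_apply, Matrix.smul_apply]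
  ring

/-- **The axial orbital generates the three-band O–O terms**: for `ε ≠ ε_s`,
`det(ε·1 − H₄(k)) = (ε − ε_s) · det(ε·1 − H_dpp(k; c = t_sp²/(ε_s − ε)))`.
[cite: AndersenEtAl1995, §5 (`t_pp = t_sp²/(ε_s − ε)`) and Eq. (2)] -/
theorem det_secular_eq_threeBand (εd εs εp tpd tsp sx sy ε : ℝ) (hε : ε ≠ εs) :
    (ε • (1 : Matrix (Fin 4) (Fin 4) ℝ) - fourBand εd εs εp tpd tsp sx sy).det =
      (ε - εs) * (ε • (1 : Matrix (Fin 3) (Fin 3) ℝ) -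
        threeBandAxial εd εp tpd (tsp ^ 2 / (εs - ε)) sx sy).det := by
  have hne : εs - ε ≠ 0 := sub_ne_zero.mpr (Ne.symm hε)
  rw [det_smul_one_sub_fourBand, det_smul_one_sub_threeBandAxial, secularDet, uCoord, vCoord]
  field_simp
  ring

/-- Hence for `ε ≠ ε_s` the four-orbital and the generated three-band model have the same band
energies: `det(ε·1 − H₄) = 0 ⟺ det(ε·1 − H_dpp(c = t_sp²/(ε_s−ε))) = 0`.
[cite: AndersenEtAl1995, §5 and Eq. (2)] -/
theorem det_fourBand_eq_zero_iff_threeBand (εd εs εp tpd tsp sx sy ε : ℝ) (hε : ε ≠ εs) :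
    (ε • (1 : Matrix (Fin 4) (Fin 4) ℝ) - fourBand εd εs εp tpd tsp sx sy).det = 0 ↔
      (ε • (1 : Matrix (Fin 3) (Fin 3) ℝ) -
        threeBandAxial εd εp tpd (tsp ^ 2 / (εs - ε)) sx sy).det = 0 := by
  have hne : ε - εs ≠ 0 := sub_ne_zero.mpr hε
  rw [det_secular_eq_threeBand εd εs εp tpd tsp sx sy ε hε, mul_eq_zero]
  constructor
  · rintro (h | h)
    · exact absurd h hne
    · exact h
  · intro h
    exact Or.inr h

/-- The generated O–O coupling is positive below the axial level (`ε < ε_s`) — the cuprate-like sign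
(`t_pp > 0`). [cite: AndersenEtAl1995, §5 (`t_pp = t_sp²/(ε_s − ε) ≈ 1.1 eV`)] -/
theorem axial_tpp_pos (εs tsp ε : ℝ) (hε : ε < εs) (htsp : tsp ≠ 0) : 0 < tsp ^ 2 / (εs - ε) := by
  have h1 : 0 < tsp ^ 2 := by positivity
  have h2 : 0 < εs - ε := by linarith
  positivity

/-! ## §6 Sensitivity of the range parameter to the axial-orbital energy -/

/-- The range parameter as a function of the axial-orbital energy at fixed band energy `ε`:
`r(ε_s) = ½/(1 + (ε_s − ε)(ε − ε_p)/(4t_sp²))`. [cite: PavariniEtAl2001, Eq. (3) with `s(ε)` of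
Eq. (2)] -/
def rangeParamAt (εp tsp ε εs : ℝ) : ℝ := rangeParam (sFun εs εp tsp ε)

/-- **`∂r/∂ε_s = −r²(ε−ε_p)/(2t_sp²)`** (where `1 + s ≠ 0`, `t_sp ≠ 0`).
[cite: PavariniEtAl2001, Eq. (3) and p. 3 ("the larger `r` (lower `ε_s`)")] -/
theorem hasDerivAt_rangeParamAt (εp tsp ε εs : ℝ) (htsp : tsp ≠ 0)
    (h1 : 1 + sFun εs εp tsp ε ≠ 0) :
    HasDerivAt (rangeParamAt εp tsp ε)
      (-(rangeParamAt εp tsp ε εs) ^ 2 * (ε - εp) / (2 * tsp ^ 2)) εs := by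
  have h4 : 4 * tsp ^ 2 ≠ 0 := mul_ne_zero (by norm_num) (pow_ne_zero 2 htsp)
  -- the inner affine map `x ↦ 1 + (x − ε)(ε − ε_p)/(4 t_sp²)`
  have hin : HasDerivAt (fun x : ℝ => 1 + sFun x εp tsp ε) ((ε - εp) / (4 * tsp ^ 2)) εs := by
    have h0 : HasDerivAt (fun x : ℝ => (x - ε) * (ε - εp) / (4 * tsp ^ 2))
        (1 * (ε - εp) / (4 * tsp ^ 2)) εs := by
      exact ((hasDerivAt_id' εs).sub_const ε).mul_const (ε - εp) |>.div_const (4 * tsp ^ 2)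
    have h0' := h0.const_add 1
    simp only [one_mul] at h0'
    refine h0'.congr_of_eventuallyEq ?_
    exact Filter.Eventually.of_forall (fun x => by simp [sFun])
  have hinv := hin.inv h1
  have hfin := hinv.const_mul (1 / 2 : ℝ)
  have hfin' : HasDerivAt (rangeParamAt εp tsp ε)
      ((1 / 2 : ℝ) * (-((ε - εp) / (4 * tsp ^ 2)) / (1 + sFun εs εp tsp ε) ^ 2)) εs := by
    refine hfin.congr_of_eventuallyEq (Filter.Eventually.of_forall fun x => ?_)
    simp [rangeParamAt, rangeParam, div_eq_mul_inv]
  convert hfin' using 1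
  unfold rangeParamAt rangeParam
  field_simp
  ring

/-- Above the O level (`ε > ε_p`) and in the regime `1 + s > 0` the derivative is NEGATIVE: lowering
the axial orbital towards the band raises `r` (hence `t′/t`). [cite: PavariniEtAl2001, p. 3] -/
theorem deriv_rangeParamAt_neg (εp tsp ε εs : ℝ) (htsp : tsp ≠ 0) (hε : εp < ε)
    (h1 : 0 < 1 + sFun εs εp tsp ε) :
    -(rangeParamAt εp tsp ε εs) ^ 2 * (ε - εp) / (2 * tsp ^ 2) < 0 := by
  have hr : 0 < rangeParamAt εp tsp ε εs := by
    unfold rangeParamAt rangeParam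
    positivity
  have h2 : 0 < rangeParamAt εp tsp ε εs ^ 2 * (ε - εp) / (2 * tsp ^ 2) := by
    have : 0 < tsp ^ 2 := by positivity
    have : 0 < ε - εp := by linarith
    positivity
  have e : -(rangeParamAt εp tsp ε εs) ^ 2 * (ε - εp) / (2 * tsp ^ 2) =
      -(rangeParamAt εp tsp ε εs ^ 2 * (ε - εp) / (2 * tsp ^ 2)) := by ring
  rw [e]
  linarith

/-- Monotonicity, stated pointwise: for `ε > ε_p`, `t_sp ≠ 0` and two axial energies `ε_s < ε_s'`
both in the regime `1 + s > 0`, the lower axial level has the LARGER range parameter.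
[cite: PavariniEtAl2001, p. 3 ("the materials with the larger `r` (lower `ε_s`) tend to be those with
the higher observed values of `T_c max`")] -/
theorem rangeParamAt_lt_of_lt (εp tsp ε εs εs' : ℝ) (htsp : tsp ≠ 0) (hε : εp < ε) (hlt : εs < εs')
    (h1 : 0 < 1 + sFun εs εp tsp ε) :
    rangeParamAt εp tsp ε εs' < rangeParamAt εp tsp ε εs := by
  have h4 : 0 < 4 * tsp ^ 2 := by positivity
  have hs : sFun εs εp tsp ε < sFun εs' εp tsp ε := by
    unfold sFun
    apply div_lt_div_of_pos_right _ h4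
    have : 0 < ε - εp := by linarith
    nlinarith
  have h1' : 0 < 1 + sFun εs' εp tsp ε := by linarith
  unfold rangeParamAt rangeParam
  apply div_lt_div_of_pos_left (by norm_num) h1
  linarith

/-! ## §7 How large is `o(r)`? — explicit bounds on the remainder of the `2ru` expansion -/

/-- In the regime of the expansion (`0 ≤ r`, `2r|u| < 1`) the denominator `1 − 2ru` is positive.
[cite: PavariniEtAl2001, Eq. (3) (expansion in powers of `2ru`)] -/
theorem one_sub_two_mul_rangeParam_mul_pos (u s : ℝ) (hr : 0 ≤ rangeParam s)
    (h : 2 * rangeParam s * |u| < 1) : 0 < 1 - 2 * rangeParam s * u := by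
  have hu : 2 * rangeParam s * u ≤ 2 * rangeParam s * |u| :=
    mul_le_mul_of_nonneg_left (le_abs_self u) (by positivity)
  linarith

/-- **Remainder bound.**  `|2r/(1−2ru) − 2r| ≤ 4r²|u| / (1 − 2r|u|)` for `0 ≤ r` and `2r|u| < 1`: the
terms dropped when `2r/(1−2ru)` is truncated at first order (the `o(r)` of `t′ = [r + o(r)]/4ḋ`) are
second order in `r`. [cite: PavariniEtAl2001, Eq. (3) and p. 3 (`t′ = [r+o(r)]/4ḋ`)] -/
theorem abs_rangeParam_remainder_le (u s : ℝ) (hr : 0 ≤ rangeParam s)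
    (h : 2 * rangeParam s * |u| < 1) :
    |2 * rangeParam s / (1 - 2 * rangeParam s * u) - 2 * rangeParam s| ≤
      4 * rangeParam s ^ 2 * |u| / (1 - 2 * rangeParam s * |u|) := by
  set r := rangeParam s with hr_def
  have hpos : 0 < 1 - 2 * r * u := one_sub_two_mul_rangeParam_mul_pos u s hr h
  have hpos' : 0 < 1 - 2 * r * |u| := by linarith
  rw [rangeParam_expansion_remainder u s hpos.ne', add_sub_cancel_left, abs_div,
    abs_of_pos hpos, abs_mul, abs_of_nonneg (by positivity : (0:ℝ) ≤ 4 * r ^ 2)]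
  -- `4r²|u| / (1 − 2ru) ≤ 4r²|u| / (1 − 2r|u|)` since `1 − 2r|u| ≤ 1 − 2ru`
  apply div_le_div_of_nonneg_left (by positivity) hpos'
  have hu : 2 * r * u ≤ 2 * r * |u| := mul_le_mul_of_nonneg_left (le_abs_self u) (by positivity)
  linarith

/-- On the Brillouin zone (`|u| ≤ 1`) and for `0 ≤ r < ½`: `|2r/(1−2ru) − 2r| ≤ 4r²/(1 − 2r)`, i.e.
relative to the first-order term `2r` the remainder is at most the factor `2r/(1−2r)` (≈ 0.5 at the
La₂CuO₄ value `r ≈ 0.17`, ≈ 2 at `r ≈ 0.33`; hence "when `r ≳ 0.2` the series must be carried beyond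
`t″`"). [cite: PavariniEtAl2001, Eq. (3) and p. 3] -/
theorem abs_rangeParam_remainder_le_of_abs_le_one (u s : ℝ) (hr : 0 ≤ rangeParam s)
    (hr2 : rangeParam s < 1 / 2) (hu : |u| ≤ 1) :
    |2 * rangeParam s / (1 - 2 * rangeParam s * u) - 2 * rangeParam s| ≤
      4 * rangeParam s ^ 2 / (1 - 2 * rangeParam s) := by
  set r := rangeParam s with hr_def
  have h1 : 2 * r * |u| < 1 := by nlinarith [abs_nonneg u]
  have hb := abs_rangeParam_remainder_le u s hr h1
  have hpos : 0 < 1 - 2 * r := by linarith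
  have hpos' : 0 < 1 - 2 * r * |u| := by nlinarith [abs_nonneg u]
  calc |2 * r / (1 - 2 * r * u) - 2 * r| ≤ 4 * r ^ 2 * |u| / (1 - 2 * r * |u|) := hb
    _ ≤ 4 * r ^ 2 / (1 - 2 * r) := by
        rw [div_le_div_iff₀ hpos' hpos]
        have h4 : 0 ≤ 4 * r ^ 2 := by positivity
        nlinarith [mul_nonneg h4 (abs_nonneg u), mul_nonneg h4 hr, abs_nonneg u,
          mul_nonneg (mul_nonneg h4 hr) (sub_nonneg.mpr hu)]

/-- The same bound carried onto the contour equation: the exact one-band right-hand side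
`2r v²/(1−2ru)` differs from its first-order reading `2r v²` by at most `(2r/(1−2r))·(2r v²)`
(`0 ≤ r < ½`, `|u| ≤ 1`). [cite: PavariniEtAl2001, Eqs. (2)–(3) and p. 3] -/
theorem abs_contour_rhs_sub_firstOrder_le (u v s : ℝ) (hr : 0 ≤ rangeParam s)
    (hr2 : rangeParam s < 1 / 2) (hu : |u| ≤ 1) :
    |2 * rangeParam s * v ^ 2 / (1 - 2 * rangeParam s * u) - 2 * rangeParam s * v ^ 2| ≤
      (2 * rangeParam s / (1 - 2 * rangeParam s)) * (2 * rangeParam s * v ^ 2) := by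
  set r := rangeParam s with hr_def
  have hb := abs_rangeParam_remainder_le_of_abs_le_one u s hr hr2 hu
  have e1 : 2 * r * v ^ 2 / (1 - 2 * r * u) - 2 * r * v ^ 2 =
      (2 * r / (1 - 2 * r * u) - 2 * r) * v ^ 2 := by ring
  have e2 : (2 * r / (1 - 2 * r)) * (2 * r * v ^ 2) = (4 * r ^ 2 / (1 - 2 * r)) * v ^ 2 := by ring
  rw [e1, e2, abs_mul, abs_of_nonneg (sq_nonneg v)]
  exact mul_le_mul_of_nonneg_right hb (sq_nonneg v)

/-! ## §8 Two layers coupled through the axial orbital: even/odd layer combinations see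
`ε_s ± t_ss^⊥`, and the interlayer splitting of the one-band function is `∝ v²` -/

/-- The on-site matrix unit of the axial orbital (basis index 1 = Cu `s`). [cite: PavariniEtAl2001,
p. 2–3 (interlayer hopping `t_ss^⊥` proceeds via Cu `s`)] -/
def sUnit : Matrix (Fin 4) (Fin 4) ℝ := !![0, 0, 0, 0; 0, 1, 0, 0; 0, 0, 0, 0; 0, 0, 0, 0]

/-- Shifting the axial level: `H(ε_s) + t·E_ss = H(ε_s + t)`. [cite: PavariniEtAl2001, p. 3 ("the
bilayer bonding and antibonding subbands have `ε_s`-values split by `∓t_ss^⊥`")] -/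
theorem fourBand_add_smul_sUnit (εd εs εp tpd tsp sx sy t : ℝ) :
    fourBand εd εs εp tpd tsp sx sy + t • sUnit = fourBand εd (εs + t) εp tpd tsp sx sy := by
  ext i j
  fin_cases i <;> fin_cases j <;> simp [fourBand, sUnit]

/-- `H(ε_s) − t·E_ss = H(ε_s − t)`. [cite: PavariniEtAl2001, p. 3] -/
theorem fourBand_sub_smul_sUnit (εd εs εp tpd tsp sx sy t : ℝ) :
    fourBand εd εs εp tpd tsp sx sy - t • sUnit = fourBand εd (εs - t) εp tpd tsp sx sy := by
  ext i j
  fin_cases i <;> fin_cases j <;> simp [fourBand, sUnit]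

/-- Two identical four-orbital layers coupled ONLY by the axial–axial interlayer hopping `t_ss^⊥`
(block matrix over layer 1 ⊕ layer 2). [cite: PavariniEtAl2001, p. 2–3]; [cite: AndersenEtAl1995,
Abstract ("Cu s provides … hopping between planes (t⊥)")] -/
def bilayer (εd εs εp tpd tsp tss sx sy : ℝ) : Matrix (Fin 4 ⊕ Fin 4) (Fin 4 ⊕ Fin 4) ℝ :=
  Matrix.fromBlocks (fourBand εd εs εp tpd tsp sx sy) (tss • sUnit) (tss • sUnit)
    (fourBand εd εs εp tpd tsp sx sy)

/-- Block algebra: `[[1,1],[0,1]]·[[A,B],[B,A]]·[[1,−1],[0,1]] = [[A+B, 0],[B, A−B]]`.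
[cite: PavariniEtAl2001, p. 3 (even/odd layer combinations)] -/
theorem fromBlocks_symm_conj {m : Type*} [Fintype m] [DecidableEq m] (A B : Matrix m m ℝ) :
    Matrix.fromBlocks 1 1 0 1 * Matrix.fromBlocks A B B A * Matrix.fromBlocks 1 (-1) 0 1 =
      Matrix.fromBlocks (A + B) 0 B (A - B) := by
  simp only [Matrix.fromBlocks_multiply, Matrix.one_mul, Matrix.zero_mul, Matrix.mul_one,
    Matrix.mul_zero, Matrix.mul_neg, zero_add, add_zero]
  congr 1 <;> abel

/-- **`det [[A,B],[B,A]] = det(A+B)·det(A−B)`** (even/odd decoupling of two identical coupled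
blocks). [cite: PavariniEtAl2001, p. 3] -/
theorem det_fromBlocks_symm {m : Type*} [Fintype m] [DecidableEq m] (A B : Matrix m m ℝ) :
    (Matrix.fromBlocks A B B A).det = (A + B).det * (A - B).det := by
  have h := congrArg Matrix.det (fromBlocks_symm_conj A B)
  rw [Matrix.det_mul, Matrix.det_mul, Matrix.det_fromBlocks_zero₂₁, Matrix.det_fromBlocks_zero₂₁,
    Matrix.det_fromBlocks_zero₁₂] at h
  simpa using h

/-- The EVEN layer combination `(x, x)` is mapped by the bilayer matrix as the single layer with
`ε_s → ε_s + t_ss^⊥`. [cite: PavariniEtAl2001, p. 3] -/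
theorem bilayer_mulVec_even (εd εs εp tpd tsp tss sx sy : ℝ) (x : Fin 4 → ℝ) :
    bilayer εd εs εp tpd tsp tss sx sy *ᵥ Sum.elim x x =
      Sum.elim (fourBand εd (εs + tss) εp tpd tsp sx sy *ᵥ x)
        (fourBand εd (εs + tss) εp tpd tsp sx sy *ᵥ x) := by
  rw [bilayer, Matrix.fromBlocks_mulVec, ← fourBand_add_smul_sUnit, Matrix.add_mulVec]
  simp only [Sum.elim_comp_inl, Sum.elim_comp_inr]
  congr 1
  all_goals abel

/-- The ODD layer combination `(x, −x)` sees `ε_s → ε_s − t_ss^⊥`. [cite: PavariniEtAl2001, p. 3] -/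
theorem bilayer_mulVec_odd (εd εs εp tpd tsp tss sx sy : ℝ) (x : Fin 4 → ℝ) :
    bilayer εd εs εp tpd tsp tss sx sy *ᵥ Sum.elim x (-x) =
      Sum.elim (fourBand εd (εs - tss) εp tpd tsp sx sy *ᵥ x)
        (-(fourBand εd (εs - tss) εp tpd tsp sx sy *ᵥ x)) := by
  rw [bilayer, Matrix.fromBlocks_mulVec, ← fourBand_sub_smul_sUnit, Matrix.sub_mulVec]
  simp only [Sum.elim_comp_inl, Sum.elim_comp_inr, Matrix.mulVec_neg]
  congr 1
  all_goals abel

/-- **The bilayer secular determinant factorises into the two single-layer determinants with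
`ε_s ± t_ss^⊥`**: `det(ε·1 − H_bilayer) = P(ε; ε_s + t_ss)·P(ε; ε_s − t_ss)` with the closed form
`P = secularDet` of §1. [cite: PavariniEtAl2001, p. 3 ("ε_s-values split by ∓t_ss^⊥")] -/
theorem det_smul_one_sub_bilayer (εd εs εp tpd tsp tss sx sy ε : ℝ) :
    (ε • (1 : Matrix (Fin 4 ⊕ Fin 4) (Fin 4 ⊕ Fin 4) ℝ) - bilayer εd εs εp tpd tsp tss sx sy).det =
      secularDet εd (εs + tss) εp tpd tsp sx sy ε * secularDet εd (εs - tss) εp tpd tsp sx sy ε := by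
  have e : ε • (1 : Matrix (Fin 4 ⊕ Fin 4) (Fin 4 ⊕ Fin 4) ℝ) - bilayer εd εs εp tpd tsp tss sx sy =
      Matrix.fromBlocks (ε • (1 : Matrix (Fin 4) (Fin 4) ℝ) - fourBand εd εs εp tpd tsp sx sy)
        (-(tss • sUnit)) (-(tss • sUnit))
        (ε • (1 : Matrix (Fin 4) (Fin 4) ℝ) - fourBand εd εs εp tpd tsp sx sy) := by
    rw [bilayer, ← Matrix.fromBlocks_one, Matrix.fromBlocks_smul, sub_eq_add_neg, Matrix.fromBlocks_neg,
      Matrix.fromBlocks_add]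
    simp [sub_eq_add_neg]
  rw [e, det_fromBlocks_symm]
  have e1 : ε • (1 : Matrix (Fin 4) (Fin 4) ℝ) - fourBand εd εs εp tpd tsp sx sy + -(tss • sUnit) =
      ε • 1 - fourBand εd (εs + tss) εp tpd tsp sx sy := by
    rw [← fourBand_add_smul_sUnit]; abel
  have e2 : ε • (1 : Matrix (Fin 4) (Fin 4) ℝ) - fourBand εd εs εp tpd tsp sx sy - -(tss • sUnit) =
      ε • 1 - fourBand εd (εs - tss) εp tpd tsp sx sy := by
    rw [← fourBand_sub_smul_sUnit]; abel
  rw [e1, e2, det_smul_one_sub_fourBand, det_smul_one_sub_fourBand]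

/-- **Interlayer splitting of the one-band function is `∝ v²`**: the odd-minus-even difference of the
one-band functions (axial levels `ε_s ∓ t_ss^⊥`) is
`(2t_pd)²/(ε−ε_p) · v² · [1/(1 + s₊(ε) − u) − 1/(1 + s₋(ε) − u)]`, `s_± = s(ε)` at `ε_s ± t_ss^⊥` —
it vanishes on the zone diagonal `v = 0` and peaks at `(π,0)` ("this same `v²`-dependence pertains to
the interlayer splitting caused by `t_ss^⊥`"). [cite: PavariniEtAl2001, p. 3] -/
theorem oneBandFun_interlayer_split (εd εs εp tpd tsp tss sx sy ε : ℝ) :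
    oneBandFun εd (εs - tss) εp tpd tsp sx sy ε - oneBandFun εd (εs + tss) εp tpd tsp sx sy ε =
      (2 * tpd) ^ 2 / (ε - εp) * vCoord sx sy ^ 2 *
        (1 / (1 + sFun (εs + tss) εp tsp ε - uCoord sx sy) -
          1 / (1 + sFun (εs - tss) εp tsp ε - uCoord sx sy)) := by
  unfold oneBandFun
  ring

/-- At `v = 0` (zone diagonal `kₓ = ±k_y`) the two one-band functions coincide: no interlayer
splitting along the nodal direction. [cite: PavariniEtAl2001, p. 3] -/
theorem oneBandFun_interlayer_split_nodal (εd εs εp tpd tsp tss s ε : ℝ) :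
    oneBandFun εd (εs - tss) εp tpd tsp s s ε = oneBandFun εd (εs + tss) εp tpd tsp s s ε := by
  have hv : vCoord s s = 0 := by simp [vCoord]
  have h := oneBandFun_interlayer_split εd εs εp tpd tsp tss s s ε
  rw [hv] at h
  have h0 : oneBandFun εd (εs - tss) εp tpd tsp s s ε - oneBandFun εd (εs + tss) εp tpd tsp s s ε = 0 := by
    simpa using h
  exact sub_eq_zero.mp h0

/-! ## §9 The apical lever: what moves `ε_s` (hence `r`, hence `t′/t`) between materials -/

/-- Energy of the apical 5-atom hybrid (Cu `d_{3z²−1}` – 2 O_c `p_z` – 2 La) that the Cu `s` orbital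
couples to [printed Eq. (4)]:
`ε_c = ε_c̄ + (1 + (t_sc/t_sp)(t_pz²/t_cz²))²·4r̄·t_cz²²/(ε_F − ε_z²) − t_cLa²/(ε_La − ε_F)`.
Arguments: `εcbar εF εz2 εLa rbar tsc tsp tpz2 tcz2 tcLa`. [cite: PavariniEtAl2001, Eq. (4)] -/
def apicalHybridLevel (εcbar εF εz2 εLa rbar tsc tsp tpz2 tcz2 tcLa : ℝ) : ℝ :=
  εcbar + (1 + tsc / tsp * (tpz2 / tcz2)) ^ 2 * (4 * rbar * tcz2 ^ 2) / (εF - εz2)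
    - tcLa ^ 2 / (εLa - εF)

/-- The same level with the prefactor multiplied out: `ε_c = ε_c̄ + 4r̄(t_cz² + t_sc t_pz²/t_sp)²/(ε_F − ε_z²)
− t_cLa²/(ε_La − ε_F)` (for `t_cz² ≠ 0`) — monotone increasing in the apical couplings when
`ε_F > ε_z²`. [cite: PavariniEtAl2001, Eq. (4)] -/
theorem apicalHybridLevel_eq (εcbar εF εz2 εLa rbar tsc tsp tpz2 tcz2 tcLa : ℝ) (h : tcz2 ≠ 0) :
    apicalHybridLevel εcbar εF εz2 εLa rbar tsc tsp tpz2 tcz2 tcLa =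
      εcbar + 4 * rbar * (tcz2 + tsc * tpz2 / tsp) ^ 2 / (εF - εz2) - tcLa ^ 2 / (εLa - εF) := by
  unfold apicalHybridLevel
  have e : (1 + tsc / tsp * (tpz2 / tcz2)) ^ 2 * (4 * rbar * tcz2 ^ 2) =
      4 * rbar * (tcz2 + tsc * tpz2 / tsp) ^ 2 := by
    have e1 : (1 + tsc / tsp * (tpz2 / tcz2)) * tcz2 = tcz2 + tsc * tpz2 / tsp := by
      field_simp
    calc (1 + tsc / tsp * (tpz2 / tcz2)) ^ 2 * (4 * rbar * tcz2 ^ 2)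
        = 4 * rbar * ((1 + tsc / tsp * (tpz2 / tcz2)) * tcz2) ^ 2 := by ring
      _ = 4 * rbar * (tcz2 + tsc * tpz2 / tsp) ^ 2 := by rw [e1]
  rw [e]

/-- Energy of the AXIAL orbital: the Cu `s` level pushed up by its coupling `t_sc` to the apical
hybrid at `ε_c`: `ε_s = ε_s̄ + 2t_sc²/(ε_F − ε_c)`. [cite: PavariniEtAl2001, p. 4 (text after
Eq. (4))] -/
def axialLevel (εsbar εF εc tsc : ℝ) : ℝ := εsbar + 2 * tsc ^ 2 / (εF - εc)

/-- With the apical hybrid BELOW the Fermi level (`ε_c < ε_F`), a weaker Cu-s/apical coupling gives a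
LOWER axial level: `t_sc₁² < t_sc₂² ⇒ ε_s(t_sc₁) < ε_s(t_sc₂)` ("`ε_s` is lowered towards `ε_F`
when the coupling between O_c `p_z` and Cu `d_{3z²−1}/s` is weakened"). [cite: PavariniEtAl2001,
p. 4] -/
theorem axialLevel_lt_of_sq_lt (εsbar εF εc tsc₁ tsc₂ : ℝ) (hc : εc < εF)
    (h : tsc₁ ^ 2 < tsc₂ ^ 2) : axialLevel εsbar εF εc tsc₁ < axialLevel εsbar εF εc tsc₂ := by
  unfold axialLevel
  have hpos : 0 < εF - εc := by linarith
  have : 2 * tsc₁ ^ 2 / (εF - εc) < 2 * tsc₂ ^ 2 / (εF - εc) := by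
    apply div_lt_div_of_pos_right _ hpos
    linarith
  linarith

/-- The axial level also rises when the apical hybrid rises towards `ε_F` (`ε_c₁ < ε_c₂ < ε_F`,
`t_sc ≠ 0`). [cite: PavariniEtAl2001, p. 4] -/
theorem axialLevel_lt_of_apical_lt (εsbar εF εc₁ εc₂ tsc : ℝ) (h12 : εc₁ < εc₂) (hc : εc₂ < εF)
    (htsc : tsc ≠ 0) : axialLevel εsbar εF εc₁ tsc < axialLevel εsbar εF εc₂ tsc := by
  unfold axialLevel
  have h2 : 0 < 2 * tsc ^ 2 := by positivity
  have hp1 : 0 < εF - εc₁ := by linarith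
  have hp2 : 0 < εF - εc₂ := by linarith
  have : 2 * tsc ^ 2 / (εF - εc₁) < 2 * tsc ^ 2 / (εF - εc₂) := by
    apply div_lt_div_of_pos_left h2 hp2
    linarith
  linarith

/-- Sensitivity of the axial level to the coupling: `∂ε_s/∂t_sc = 4t_sc/(ε_F − ε_c)` (stated for
all `ε_c`; at `ε_c = ε_F` both sides degenerate under the `x/0 = 0` convention).
[cite: PavariniEtAl2001, p. 4 (and `t_sc ∝ d_{Cu–O_c}^{−2}`)] -/
theorem hasDerivAt_axialLevel (εsbar εF εc tsc : ℝ) :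
    HasDerivAt (axialLevel εsbar εF εc) (4 * tsc / (εF - εc)) tsc := by
  unfold axialLevel
  have h1 : HasDerivAt (fun x : ℝ => 2 * x ^ 2 / (εF - εc)) (2 * (2 * tsc) / (εF - εc)) tsc := by
    simpa using ((hasDerivAt_pow 2 tsc).const_mul 2).div_const (εF - εc)
  have h2 := h1.const_add εsbar
  exact h2.congr_deriv (by ring)

/-- **THE APICAL LEVER** (composition of §6 and §9): at band energy `ε > ε_p`, with the apical hybrid
below `ε_F` and both axial levels in the regime `1 + s > 0`, a WEAKER Cu-s/apical coupling
(`t_sc₁² < t_sc₂²`, e.g. a LONGER Cu–O_apical distance since `t_sc ∝ d^{−2}`) gives the LARGER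
range parameter: `r(ε_s(t_sc₂)) < r(ε_s(t_sc₁))` — "`r` increases with `d_{Cu–O_c}`".
[cite: PavariniEtAl2001, p. 4 and Fig. 3 (`r` vs `d_{Cu–O_c}`)] -/
theorem rangeParam_apical_lever (εp tsp ε εsbar εF εc tsc₁ tsc₂ : ℝ) (htsp : tsp ≠ 0) (hε : εp < ε)
    (hc : εc < εF) (h : tsc₁ ^ 2 < tsc₂ ^ 2)
    (h1 : 0 < 1 + sFun (axialLevel εsbar εF εc tsc₁) εp tsp ε) :
    rangeParamAt εp tsp ε (axialLevel εsbar εF εc tsc₂) <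
      rangeParamAt εp tsp ε (axialLevel εsbar εF εc tsc₁) :=
  rangeParamAt_lt_of_lt εp tsp ε _ _ htsp hε (axialLevel_lt_of_sq_lt εsbar εF εc tsc₁ tsc₂ hc h) h1

/-! ## §10 Dimpled layers: Pavarini's `p(ε)` term reduces `t` and leaves the range (`t′`, `t″`) alone -/

/-- Pavarini's extended-saddle-point value of the dimpling function: `p = s²/(1+s)²` ("`p = 0` for flat
layers and `p = s²/(1+s)²` for layers dimpled so as to yield extended saddlepoints").
[cite: PavariniEtAl2001, p. 3 (text after Eq. (2))] -/
def dimplingESP (s : ℝ) : ℝ := s ^ 2 / (1 + s) ^ 2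

/-- `0 ≤ p = s²/(1+s)² < 1` for `s > 0`, so `1 − p > 0`: dimpling REDUCES `t = (1−p)/4ḋ` without
reversing its sign. [cite: PavariniEtAl2001, p. 3] -/
theorem dimplingESP_nonneg_lt_one (s : ℝ) (hs : 0 < s) : 0 ≤ dimplingESP s ∧ dimplingESP s < 1 := by
  unfold dimplingESP
  have h1 : 0 < (1 + s) ^ 2 := by positivity
  refine ⟨by positivity, ?_⟩
  rw [div_lt_one h1]
  nlinarith

/-- **First-order reading WITH dimpling.**  With the `(1+u)p(ε)` term of Eq. (2) kept (and `p` frozen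
at its Fermi-level value like `s`), the linearised first-order band is again a `t–t′–t″` form:
`(1−u) − d_F + (1+u)p − 2rv² = (1 + p − d_F − r/2) − ½(1−p)(cos kₓ+cos k_y) + r cos kₓ cos k_y −
(r/4)(cos 2kₓ + cos 2k_y)` — i.e. `t = (1−p)/(4ḋ)` while `t′ = r/(4ḋ)`, `t″ = r/(8ḋ)` are UNCHANGED:
"Dimpling is seen not to influence the range of the intralayer hopping, but to reduce `t` through
admixture of O_{a/b} `p_z`" (`t = [1−p+o(r)]/4ḋ`). [cite: PavariniEtAl2001, Eq. (2) and p. 3] -/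
theorem firstOrder_reading_dimpled (dF r p kx ky : ℝ) :
    (1 - uCoord (Real.sin (kx / 2)) (Real.sin (ky / 2))) - dF
        + (1 + uCoord (Real.sin (kx / 2)) (Real.sin (ky / 2))) * p
        - 2 * r * vCoord (Real.sin (kx / 2)) (Real.sin (ky / 2)) ^ 2 =
      (1 + p - dF - r / 2) + pavariniBand ((1 - p) / 4) (r / 4) (r / 8) kx ky := by
  rw [uCoord_half, vCoord_half, pavariniBand, Real.cos_two_mul, Real.cos_two_mul]
  ring

/-- Hence at first order the RANGE is dimpling-independent while the ratio `t′/t` is ENHANCED by the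
factor `1/(1−p)`: `t′/t = r/(1−p)` (for `ḋ ≠ 0`, `p ≠ 1`). [cite: PavariniEtAl2001, p. 3] -/
theorem firstOrder_tp_div_t_dimpled (dd r p : ℝ) (hdd : dd ≠ 0) (hp : p ≠ 1) :
    (r / (4 * dd)) / ((1 - p) / (4 * dd)) = r / (1 - p) := by
  have h1 : 1 - p ≠ 0 := sub_ne_zero.mpr (Ne.symm hp)
  field_simp


/-! ## §11 Two virtual paths of opposite sign into the `x²−y²` band: an `A₁`-type level ABOVE the
band (Cu `4s`) and one BELOW it (Cu `3z²−r²`) — Sakakibara–Usui–Kuroki–Arita–Aoki 2010 -/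

/-- The conduction level `e` (the `x²−y²`-derived band at a given `k`) coupled to two mutually
uncoupled `A₁`-symmetric levels `ε₁` (Cu `4s`, above the band) and `ε₂` (Cu `3z²−r²`, below it)
through `k`-dependent hybridisations `b₁, b₂`; basis `(x²−y², level 1, level 2)`.
[cite: SakakibaraEtAl2010, p. 3 (the paths `d_{x²−y²} → 4s → d_{x²−y²}` and
`d_{x²−y²} → d_{z²} → d_{x²−y²}` of the three-orbital model)] -/
def threeLevel (e ε₁ ε₂ b₁ b₂ : ℝ) : Matrix (Fin 3) (Fin 3) ℝ :=
  !![e, b₁, b₂; b₁, ε₁, 0; b₂, 0, ε₂]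

/-- The three-level matrix is real symmetric. [cite: SakakibaraEtAl2010, p. 3] -/
theorem threeLevel_isSymm (e ε₁ ε₂ b₁ b₂ : ℝ) : (threeLevel e ε₁ ε₂ b₁ b₂).IsSymm := by
  unfold threeLevel Matrix.IsSymm
  ext i j
  fin_cases i <;> fin_cases j <;> rfl

/-- The second-order (Löwdin) shift of the conduction level generated by ONE eliminated level `ε_ℓ`
with hybridisation `b`, at band energy `ε`: `b²/(ε − ε_ℓ)`.
[cite: SakakibaraEtAl2010, p. 3]; [cite: AndersenEtAl1995, §5 (`t_pp = t_sp²/(ε_s − ε)`, the same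
second-order structure for the `s` path)] -/
def pathShift (b ε εℓ : ℝ) : ℝ := b ^ 2 / (ε - εℓ)

/-- Characteristic determinant of the three-level model (all parameters):
`det(ε·1 − H₃) = (ε−e)(ε−ε₁)(ε−ε₂) − b₁²(ε−ε₂) − b₂²(ε−ε₁)`. [cite: SakakibaraEtAl2010, p. 3] -/
theorem det_smul_one_sub_threeLevel (e ε₁ ε₂ b₁ b₂ ε : ℝ) :
    (ε • (1 : Matrix (Fin 3) (Fin 3) ℝ) - threeLevel e ε₁ ε₂ b₁ b₂).det =
      (ε - e) * (ε - ε₁) * (ε - ε₂) - b₁ ^ 2 * (ε - ε₂) - b₂ ^ 2 * (ε - ε₁) := by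
  simp [threeLevel, Matrix.det_fin_three, Matrix.sub_apply, Matrix.smul_apply]
  ring

/-- **Löwdin elimination of both levels — the two paths ADD**: for `ε ≠ ε₁`, `ε ≠ ε₂`,
`det(ε·1 − H₃) = (ε−ε₁)(ε−ε₂)·(ε − [e + b₁²/(ε−ε₁) + b₂²/(ε−ε₂)])`.
[cite: SakakibaraEtAl2010, p. 3 ("the two contributions to the main band")] -/
theorem det_threeLevel_eq_loewdin (e ε₁ ε₂ b₁ b₂ ε : ℝ) (h₁ : ε ≠ ε₁) (h₂ : ε ≠ ε₂) :
    (ε • (1 : Matrix (Fin 3) (Fin 3) ℝ) - threeLevel e ε₁ ε₂ b₁ b₂).det =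
      (ε - ε₁) * (ε - ε₂) * (ε - (e + pathShift b₁ ε ε₁ + pathShift b₂ ε ε₂)) := by
  have hne₁ : ε - ε₁ ≠ 0 := sub_ne_zero.mpr h₁
  have hne₂ : ε - ε₂ ≠ 0 := sub_ne_zero.mpr h₂
  rw [det_smul_one_sub_threeLevel]
  unfold pathShift
  field_simp
  ring

/-- Hence the band energies away from the two levels: for `ε ≠ ε₁, ε₂`,
`det(ε·1 − H₃) = 0 ⟺ ε = e + b₁²/(ε−ε₁) + b₂²/(ε−ε₂)`. [cite: SakakibaraEtAl2010, p. 3] -/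
theorem det_threeLevel_eq_zero_iff (e ε₁ ε₂ b₁ b₂ ε : ℝ) (h₁ : ε ≠ ε₁) (h₂ : ε ≠ ε₂) :
    (ε • (1 : Matrix (Fin 3) (Fin 3) ℝ) - threeLevel e ε₁ ε₂ b₁ b₂).det = 0 ↔
      ε = e + pathShift b₁ ε ε₁ + pathShift b₂ ε ε₂ := by
  have hne₁ : ε - ε₁ ≠ 0 := sub_ne_zero.mpr h₁
  have hne₂ : ε - ε₂ ≠ 0 := sub_ne_zero.mpr h₂
  rw [det_threeLevel_eq_loewdin e ε₁ ε₂ b₁ b₂ ε h₁ h₂, mul_eq_zero, mul_eq_zero]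
  constructor
  · rintro ((h | h) | h)
    · exact absurd h hne₁
    · exact absurd h hne₂
    · exact sub_eq_zero.mp h
  · intro h
    exact Or.inr (sub_eq_zero.mpr h)

/-- A level ABOVE the band energy pushes the conduction level DOWN: `ε < ε_ℓ`, `b ≠ 0` ⇒
`b²/(ε−ε_ℓ) < 0`. [cite: SakakibaraEtAl2010, p. 3 ("`4s` above")] -/
theorem pathShift_neg_of_lt (b ε εℓ : ℝ) (h : ε < εℓ) (hb : b ≠ 0) : pathShift b ε εℓ < 0 := by
  unfold pathShift
  have h1 : 0 < b ^ 2 := by positivity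
  have h2 : ε - εℓ < 0 := by linarith
  exact div_neg_of_pos_of_neg h1 h2

/-- A level BELOW the band energy pushes the conduction level UP: `ε_ℓ < ε`, `b ≠ 0` ⇒
`0 < b²/(ε−ε_ℓ)`. [cite: SakakibaraEtAl2010, p. 3 ("the `d_{z²}` level lies below")] -/
theorem pathShift_pos_of_lt (b ε εℓ : ℝ) (h : εℓ < ε) (hb : b ≠ 0) : 0 < pathShift b ε εℓ := by
  unfold pathShift
  have h1 : 0 < b ^ 2 := by positivity
  have h2 : 0 < ε - εℓ := by linarith
  positivity

/-- Among levels BELOW the band, the CLOSER one shifts more: `ε_ℓ < ε_ℓ' < ε` ⇒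
`b²/(ε−ε_ℓ) < b²/(ε−ε_ℓ')`. [cite: SakakibaraEtAl2010, p. 3 ("the cancellation should be strong
when the energy of the `d_{z²}` orbital is high as in La")] -/
theorem pathShift_lt_of_lt_below (b ε εℓ εℓ' : ℝ) (h : εℓ < εℓ') (h' : εℓ' < ε) (hb : b ≠ 0) :
    pathShift b ε εℓ < pathShift b ε εℓ' := by
  unfold pathShift
  have h1 : 0 < b ^ 2 := by positivity
  have h2 : 0 < ε - εℓ := by linarith
  have h3 : 0 < ε - εℓ' := by linarith
  rw [div_lt_div_iff_of_pos_left h1 h2 h3]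
  linarith

/-- A `B₁g` form factor: the effective `x²−y²`–`A₁` coupling through the oxygens is
`b(k) = w(cos kₓ − cos k_y) = 2w·v` in the file's coordinate `v` (`vCoord_half`).
[cite: AndersenEtAl1995, Eqs. (5)–(6) (the `sd` off-diagonal `∝ v`)];
[cite: SakakibaraEtAl2010, p. 3] -/
theorem formFactor_eq_two_mul_vCoord (w kx ky : ℝ) :
    w * (Real.cos kx - Real.cos ky) = 2 * w * vCoord (Real.sin (kx / 2)) (Real.sin (ky / 2)) := by
  rw [vCoord_half]
  ring

/-- With a `k`-dependent coupling `b = w·φ` the shift factorises: `(wφ)²/(ε−ε_ℓ) = w²/(ε−ε_ℓ)·φ²`.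
[cite: SakakibaraEtAl2010, p. 3] -/
theorem pathShift_mul_formFactor (w φ ε εℓ : ℝ) :
    pathShift (w * φ) ε εℓ = pathShift w ε εℓ * φ ^ 2 := by
  unfold pathShift
  ring

/-- **The squared `B₁g` form factor is a pure `t′–t″` dispersion with `t″ = ½t′`**:
`C(cos kₓ − cos k_y)² = C + pavariniBand 0 (−C/2) (−C/4) kₓ k_y` — no nearest-neighbour part, a
constant `C`, `t′ = −C/2`, `t″ = −C/4`. [cite: PavariniEtAl2001, Eq. (1) and p. 3 (`t″ ≈ ½t′`: all
further hoppings proceed via the axial orbital)]; [cite: SakakibaraEtAl2010, p. 3] -/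
theorem formFactor_sq_eq_pavariniBand (C kx ky : ℝ) :
    C * (Real.cos kx - Real.cos ky) ^ 2 = C + pavariniBand 0 (-C / 2) (-C / 4) kx ky := by
  rw [pavariniBand, Real.cos_two_mul, Real.cos_two_mul]
  ring

/-- The `t′` generated by ONE `A₁` path with `B₁g` coupling `w(cos kₓ − cos k_y)` at band energy `ε`,
in the sign convention of `pavariniBand` (`+4t′ cos kₓ cos k_y`): `t′_ℓ = −w²/(2(ε − ε_ℓ))`.
[cite: SakakibaraEtAl2010, p. 3]; [cite: PavariniEtAl2001, p. 3] -/
def pathTp (w ε εℓ : ℝ) : ℝ := -pathShift w ε εℓ / 2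

/-- The `t″` generated by the same path: `t″_ℓ = −w²/(4(ε − ε_ℓ))`.
[cite: SakakibaraEtAl2010, p. 3]; [cite: PavariniEtAl2001, p. 3] -/
def pathTpp (w ε εℓ : ℝ) : ℝ := -pathShift w ε εℓ / 4

/-- `t″_ℓ = ½ t′_ℓ` for every single `A₁` path — Pavarini's first-order `t″ = ½t′` again
(`firstOrder_tpp_div_tp`). [cite: PavariniEtAl2001, p. 3] -/
theorem pathTpp_eq_half_pathTp (w ε εℓ : ℝ) : pathTpp w ε εℓ = (1 / 2) * pathTp w ε εℓ := by
  unfold pathTpp pathTp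
  ring

/-- **The dispersion one path generates**: `(w(cos kₓ − cos k_y))²/(ε−ε_ℓ) =
w²/(ε−ε_ℓ) + pavariniBand 0 t′_ℓ t″_ℓ` with `t′_ℓ = pathTp`, `t″_ℓ = pathTpp`.
[cite: SakakibaraEtAl2010, p. 3]; [cite: PavariniEtAl2001, Eq. (1)] -/
theorem pathShift_formFactor_eq_pavariniBand (w ε εℓ kx ky : ℝ) :
    pathShift (w * (Real.cos kx - Real.cos ky)) ε εℓ =
      pathShift w ε εℓ + pavariniBand 0 (pathTp w ε εℓ) (pathTpp w ε εℓ) kx ky := by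
  unfold pathTp pathTpp pathShift pavariniBand
  rw [Real.cos_two_mul, Real.cos_two_mul]
  ring

/-- **Level ABOVE the band ⇒ POSITIVE `t′`** (the Cu `4s` / axial path of Andersen–Pavarini):
`ε < ε_ℓ`, `w ≠ 0` ⇒ `0 < t′_ℓ`. [cite: SakakibaraEtAl2010, p. 3 ("it is the path
`d_{x²−y²} → 4s → d_{x²−y²}` that gives the effectively large `t₂, t₃`")] -/
theorem pathTp_pos_of_lt (w ε εℓ : ℝ) (h : ε < εℓ) (hw : w ≠ 0) : 0 < pathTp w ε εℓ := by
  have h1 := pathShift_neg_of_lt w ε εℓ h hw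
  unfold pathTp
  linarith

/-- **Level BELOW the band ⇒ NEGATIVE `t′`** (the Cu `3z²−r²` path): `ε_ℓ < ε`, `w ≠ 0` ⇒ `t′_ℓ < 0`
— "has an opposite sign to the `4s` contribution because the `d_{z²}` level lies below `d_{x²−y²}`,
while `4s` above". [cite: SakakibaraEtAl2010, p. 3] -/
theorem pathTp_neg_of_lt (w ε εℓ : ℝ) (h : εℓ < ε) (hw : w ≠ 0) : pathTp w ε εℓ < 0 := by
  have h1 := pathShift_pos_of_lt w ε εℓ h hw
  unfold pathTp
  linarith

/-- **The closer the lower level, the stronger the cancellation**: for `ε_ℓ < ε_ℓ' < ε` the `t′`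
generated by the level at `ε_ℓ'` is MORE negative than that at `ε_ℓ` — "the cancellation should be
strong when the energy of the `d_{z²}` orbital is high as in La" (two-orbital on-site
`ΔE = E_{x²−y²} − E_{z²}`: La₂CuO₄ 0.91 eV, HgBa₂CuO₄ 2.19 eV). [cite: SakakibaraEtAl2010, Table I
and p. 3] -/
theorem pathTp_lt_of_lt_below (w ε εℓ εℓ' : ℝ) (h : εℓ < εℓ') (h' : εℓ' < ε) (hw : w ≠ 0) :
    pathTp w ε εℓ' < pathTp w ε εℓ := by
  have h1 := pathShift_lt_of_lt_below w ε εℓ εℓ' h h' hw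
  unfold pathTp
  linarith

/-- **Orbital-space ladder, step 1 — keeping `z²` explicit RAISES the `x²−y²`-sector `t′`**: with the
direct part `t′₀` and the `4s` path folded in both objects, one-orbital `t′₀ + t′_s + t′_z <`
two-orbital `t′₀ + t′_s` as soon as the `z²` level lies below the band (`t′_z < 0`) — La₂CuO₄
`(|t₂|+|t₃|)/|t₁|`: 0.14 (1-orbital) `<` 0.35 (2-orbital); HgBa₂CuO₄ 0.37 `<` 0.41.
[cite: SakakibaraEtAl2010, Table I and p. 2–3] -/
theorem orbitalSpace_twoOrbital_gt_oneOrbital (t0 ws wz ε εs εz : ℝ) (hz : εz < ε) (hwz : wz ≠ 0) :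
    t0 + pathTp ws ε εs + pathTp wz ε εz < t0 + pathTp ws ε εs := by
  have h1 := pathTp_neg_of_lt wz ε εz hz hwz
  linarith

/-- **Orbital-space ladder, step 2 — folding `4s` RAISES `t′`**: three-orbital (`z²` and `4s`
explicit: direct part only) `t′₀ <` two-orbital `t′₀ + t′_s` as soon as the `4s` level lies above the
band (`t′_s > 0`) — La₂CuO₄: 0.10 (3-orbital) `<` 0.35 (2-orbital). [cite: SakakibaraEtAl2010,
Table I and p. 3] -/
theorem orbitalSpace_twoOrbital_gt_threeOrbital (t0 ws ε εs : ℝ) (hs : ε < εs) (hws : ws ≠ 0) :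
    t0 < t0 + pathTp ws ε εs := by
  have h1 := pathTp_pos_of_lt ws ε εs hs hws
  linarith

/-- **Orbital-space ladder, step 3 is NOT a sign statement**: one-orbital `t′₀ + t′_s + t′_z` exceeds
three-orbital `t′₀` iff the `4s` path outweighs the `z²` path, `t′_s + t′_z > 0`, i.e. iff the net
second-order shift `w_s²/(ε−ε_s) + w_z²/(ε−ε_z)` of the `x²−y²` level is NEGATIVE — an inequality
on `w_s², w_z², ε_s − ε, ε − ε_z`, which the printed La₂CuO₄ numbers satisfy (0.14 > 0.10) with
little room. [cite: SakakibaraEtAl2010, Table I and p. 3] -/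
theorem orbitalSpace_oneOrbital_gt_threeOrbital_iff (t0 ws wz ε εs εz : ℝ) :
    t0 < t0 + pathTp ws ε εs + pathTp wz ε εz ↔ pathShift ws ε εs + pathShift wz ε εz < 0 := by
  unfold pathTp
  constructor
  · intro h
    linarith
  · intro h
    linarith

end CuprateFourOrbital

end Literature.MathematicalPhysics.QuantumLattice
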